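import Literature.NumberTheory.EllipticCurves.AnticyclotomicSignedTransferTheorem
import HarnessLib

/-!
# Stub (a) `stub_xAcTorsionSS` of line `bdpline` (crux `AnticyclotomicEisensteinDivisibility`,
# stmt-BirchSwinnertonDyer-20727) — helper 1: the TORSION-ONLY form of Castella–Wan's transfer
# (proof of Thm. 6.8, (6.12)–(6.13) + Lemma 6.7 (2)): `TransferInputs` + `rank_Λ X_ε = 1` ⟹
# `X^{rel,str}` is finitely generated `Λ`-torsion ⟹ `X_ac(E[p^∞])` is `Λ`-torsion

Width seat bsd-line-sbc-p1-w4 (gen 0), `--supports stmt-BirchSwinnertonDyer-20727`. The registered stub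
`stub_xAcTorsionSS` asks that `AcSelmer.XAc (W.baseChange K) p κ₂ v̄ ∅ γ₂` (the dual of the `v`-relaxed /
`v̄`-strict anticyclotomic Selmer group of `E[p^∞]`, Castella–Wan's `X^{rel,str}`) be `Λ`-torsion at a good
supersingular prime. The tree PROVES the module algebra of Castella–Wan's proof of Thm. 6.8
(`AcSigned.TransferInputs.isFGTorsion_and_sq_mem_charIdeal`, file `AnticyclotomicSignedTransferTheorem`),
but packaged with the full HOWARD SIDE (`Sel_ε(K, 𝐓^ac)` of rank one, `X_ε` of rank one AND the
Kolyvagin-system divisibility) because it also delivers `(ι Log loc_𝔭 z)² ∈ char_Λ(X^{rel,str})`. For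
TORSION alone the printed argument uses only `rank_Λ X_ε = 1` (MS p. 30: "if both `X^{rel,str}` and
`Sel^{str,rel}(K, 𝐓^ac)` are `Λ^ac`-torsion, then (6.12) shows … The other implication for `Λ^ac`-ranks is
similar"): from (6.13) `0 → coker(loc_𝔭|Sel_ε) → X^{rel,ε} → X_ε → 0` with the cokernel killed by
`ι(Log loc_𝔭 z) ≠ 0` (Cor. 6.4 + Def. 6.1/Thm. 6.2) one gets `rank X^{rel,ε} = rank X_ε = 1`, Lemma 6.7 (2)
gives `rank X^{ε,str} = 0`, and (6.12) `0 → coker(loc_𝔭|Sel^{ε,rel}) → X^{rel,str} → X^{ε,str} → 0` gives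
`X^{rel,str}` torsion. This file records that weaker-hypothesis form (same proof, the tree's abstract chain
`Module.isTorsion_and_charIdeal_eq_of_surjective_pair`), so that the rank-one input can be taken from the
REFEREED Longo–Vigni 2019 Thm. 1.4 (`AcSigned.longoVigni2019_thm14_signedSelmerDual_rank_one`, which is
about `X_ε` only) rather than from Castella–Wan's Thm. A.5 (which assumes `N` square-free).

Contents (all PROVED, standard axioms; no definition, no named fact):
* `TransferInputs.isFGTorsion_at_str_rel_of_hasRank` — `TransferInputs … ε z L` + `X.HasRank … (sgn ε) 1`
  ⟹ `X^{rel,str}` f.g. torsion, `X^{ε,str}` torsion, `rank X^{rel,ε} = 1`;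
* `TransferInputs.isTorsion_XAc_of_hasRank` — the same read on `Castella2018.AcSelmer.XAc` for a base
  change `W⁄K` (bridge `X.isTorsion_XAc_of_at_str_rel`).
Nothing about elliptic curves is asserted unconditionally: the inputs are hypotheses. BSD is not proved
by this file.
-/

-- D-0017: single-problem summit, the namespace repeats the problem name by design.
set_option linter.dupNamespace false
set_option autoImplicit false

noncomputable section

open scoped Classical

open PowerSeries NumberField IsDedekindDomain Field
open Literature.NumberTheory.EllipticCurves Literature.NumberTheory.GaloisRepresentations
open Literature.NumberTheory.EllipticCurves.IwasawaDual
open Literature.NumberTheory.EllipticCurves.AcSigned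

universe u

namespace Summit.BirchSwinnertonDyer.BirchSwinnertonDyer.Theorems.SignedBaseChangeAcDivXAcTorsionTransfer

section Assembly

variable {K : Type u} [Field K] [NumberField K] {W : WeierstrassCurve K} {p : ℕ} [Fact p.Prime]
  {κ : ZpExtension K p} {γ : absoluteGaloisGroup K} {hγ : κ.IsTopGenerator γ}
  {𝔭 : HeightOneSpectrum (𝓞 K)} {h𝔭 : IsNonsplitIn κ 𝔭} {γ𝔭 : absoluteGaloisGroup (𝔭.adicCompletion K)}
  {hγ𝔭 : κ (resGalOfEmb (closureEmb (K := K) (𝔭.adicCompletion K)) γ𝔭) = κ γ}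
  {𝔭' : HeightOneSpectrum (𝓞 K)} {h𝔭𝔭' : 𝔭 ≠ 𝔭'} {h𝔭p : ((p : ℕ) : 𝓞 K) ∈ 𝔭.asIdeal} {ε : ℤˣ}
  {z : selmerLambdaAdic W p κ γ (fun _ ↦ .sgn ε)} {L : UnrSeries p}

set_option maxHeartbeats 4000000 in
set_option synthInstance.maxHeartbeats 200000 in
/-- **Torsion-only transfer (Castella–Wan, proof of Thm. 6.8, the rank half).** From the six typed inputs
`TransferInputs … ε z L` and `rank_Λ X_ε = 1` ALONE (no rank hypothesis on `Sel_ε(K, 𝐓^ac)`, no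
Kolyvagin-system divisibility): `X^{rel,str}` (`X … ∅ (PCond.at 𝔭' .str .rel)`) is finitely generated
`Λ`-torsion, `X^{ε,str}` is torsion and `rank X^{rel,ε} = 1`. Proof: the kernels of the restrictions
`X^{rel,ε} ↠ X_ε` ((6.13)) and `X^{rel,str} ↠ X^{ε,str}` ((6.12)) are the twisted cokernels
`Λ ⧸ ι(Log loc_𝔭(Sel_ε))`, `Λ ⧸ ι(Log loc_𝔭(Sel^{ε,rel}))`, both killed by `ι(Log loc_𝔭 z) ≠ 0`
(Cor. 6.4: `loc_𝔭 z ≠ 0`; `Log` is a bijection); then Lemma 6.7 (2) and rank additivity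
(`Module.isTorsion_and_charIdeal_eq_of_surjective_pair`).
[cite: CastellaWan2023, proof of Thm. 6.8, (6.12)–(6.13) and the rank count (MS p. 30); Lemma 6.7 (2) (MS p. 28); Cor. 6.4 (MS p. 27)] -/
theorem TransferInputs.isFGTorsion_at_str_rel_of_hasRank [W.IsElliptic]
    (h : TransferInputs W p κ γ hγ 𝔭 h𝔭 γ𝔭 hγ𝔭 𝔭' h𝔭𝔭' h𝔭p ε z L)
    (hX : X.HasRank W p κ ∅ (fun _ ↦ .sgn ε) hγ 1) :
    X.IsFGTorsion W p κ ∅ (PCond.at 𝔭' .str .rel) hγ ∧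
    (letI := X.moduleOfGen W p κ ∅ (PCond.at 𝔭' .str (.sgn ε)) hγ
     Module.IsTorsion (IwasawaAlgebra p) (X W p κ ∅ (PCond.at 𝔭' .str (.sgn ε)))) ∧
    X.HasRank W p κ ∅ (PCond.at 𝔭 .rel (.sgn ε)) hγ 1 := by
  -- the carriers and their module structures
  letI iS : Module (IwasawaAlgebra p) (selmerLambdaAdic W p κ γ (fun _ ↦ .sgn ε)) :=
    selmerLambdaAdic.moduleOfGen W p κ γ hγ (fun _ ↦ PCond.sgn ε)
  letI iS' : Module (IwasawaAlgebra p) (selmerLambdaAdic W p κ γ (PCond.at 𝔭' .rel (.sgn ε))) :=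
    selmerLambdaAdic.moduleOfGen W p κ γ hγ (PCond.at 𝔭' .rel (.sgn ε))
  letI iH : Module (IwasawaAlgebra p) (localSignedLambdaAdic (W.baseChange (𝔭.adicCompletion K)) p
      (localizeAt κ 𝔭 h𝔭) γ𝔭 ε) :=
    localSignedLambdaAdic.moduleOfGen (W.baseChange (𝔭.adicCompletion K)) p (localizeAt κ 𝔭 h𝔭)
      γ𝔭 (isTopGenerator_localize_of_apply_eq p κ _ h𝔭 hγ𝔭 hγ) ε
  letI iXre : Module (IwasawaAlgebra p) (X W p κ ∅ (PCond.at 𝔭 .rel (.sgn ε))) :=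
    X.moduleOfGen W p κ ∅ (PCond.at 𝔭 .rel (.sgn ε)) hγ
  letI iXe : Module (IwasawaAlgebra p) (X W p κ ∅ (fun _ ↦ .sgn ε)) :=
    X.moduleOfGen W p κ ∅ (fun _ ↦ .sgn ε) hγ
  letI iXrs : Module (IwasawaAlgebra p) (X W p κ ∅ (PCond.at 𝔭' .str .rel)) :=
    X.moduleOfGen W p κ ∅ (PCond.at 𝔭' .str .rel) hγ
  letI iXes : Module (IwasawaAlgebra p) (X W p κ ∅ (PCond.at 𝔭' .str (.sgn ε))) :=
    X.moduleOfGen W p κ ∅ (PCond.at 𝔭' .str (.sgn ε)) hγ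
  haveI : Module.Finite (IwasawaAlgebra p) (X W p κ ∅ (PCond.at 𝔭 .rel (.sgn ε))) :=
    X.module_finite_empty W p κ _ hγ
  haveI : Module.Finite (IwasawaAlgebra p) (X W p κ ∅ (fun _ ↦ .sgn ε)) :=
    X.module_finite_empty W p κ _ hγ
  haveI : Module.Finite (IwasawaAlgebra p) (X W p κ ∅ (PCond.at 𝔭' .str .rel)) :=
    X.module_finite_empty W p κ _ hγ
  haveI : Module.Finite (IwasawaAlgebra p) (X W p κ ∅ (PCond.at 𝔭' .str (.sgn ε))) :=
    X.module_finite_empty W p κ _ hγ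
  -- `Sel_ε ≤ Sel^{ε,rel}` and the two localisation maps agree on it
  have hle : selmerLambdaAdic W p κ γ (fun _ ↦ .sgn ε) ≤
      selmerLambdaAdic W p κ γ (PCond.at 𝔭' .rel (.sgn ε)) :=
    selmerLambdaAdic_sgn_le_at_rel W p κ γ 𝔭' ε
  have hloc'_incl : ∀ x : selmerLambdaAdic W p κ γ (fun _ ↦ .sgn ε),
      locSignedAt W p κ 𝔭 h𝔭 γ γ𝔭 hγ𝔭 (PCond.at 𝔭' .rel (.sgn ε)) ε (PCond.at_of_ne .rel (.sgn ε) h𝔭𝔭') h𝔭p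
          (AddSubgroup.inclusion hle x) =
        locSignedAt W p κ 𝔭 h𝔭 γ γ𝔭 hγ𝔭 (fun _ ↦ .sgn ε) ε rfl h𝔭p x := fun x ↦ Subtype.ext rfl
  -- a signed logarithm (Def. 6.1 / Thm. 6.2)
  obtain ⟨Log, hLog, -⟩ := h.signedLog_erl
  -- `Λ`-linear packaging of `loc_𝔭` (on `Sel_ε`, `Sel^{ε,rel}`) and of `Log`
  have hloc_smul : ∀ (f : IwasawaAlgebra p) (x : selmerLambdaAdic W p κ γ (fun _ ↦ .sgn ε)),
      locSignedAt W p κ 𝔭 h𝔭 γ γ𝔭 hγ𝔭 (fun _ ↦ .sgn ε) ε rfl h𝔭p (f • x) =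
        f • locSignedAt W p κ 𝔭 h𝔭 γ γ𝔭 hγ𝔭 (fun _ ↦ .sgn ε) ε rfl h𝔭p x :=
    fun f x ↦ locSignedAt_smul W p κ 𝔭 h𝔭 hγ𝔭 hγ rfl h𝔭p f x
  have hloc'_smul : ∀ (f : IwasawaAlgebra p)
      (x : selmerLambdaAdic W p κ γ (PCond.at 𝔭' .rel (.sgn ε))),
      locSignedAt W p κ 𝔭 h𝔭 γ γ𝔭 hγ𝔭 (PCond.at 𝔭' .rel (.sgn ε)) ε
          (PCond.at_of_ne .rel (.sgn ε) h𝔭𝔭') h𝔭p (f • x) =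
        f • locSignedAt W p κ 𝔭 h𝔭 γ γ𝔭 hγ𝔭 (PCond.at 𝔭' .rel (.sgn ε)) ε
          (PCond.at_of_ne .rel (.sgn ε) h𝔭𝔭') h𝔭p x :=
    fun f x ↦ locSignedAt_smul W p κ 𝔭 h𝔭 hγ𝔭 hγ (PCond.at_of_ne .rel (.sgn ε) h𝔭𝔭') h𝔭p f x
  obtain ⟨Logₗ, hLogₗ⟩ : ∃ Logₗ : localSignedLambdaAdic (W.baseChange (𝔭.adicCompletion K)) p
      (localizeAt κ 𝔭 h𝔭) γ𝔭 ε →ₗ[IwasawaAlgebra p] IwasawaAlgebra p, ∀ y, Logₗ y = Log y :=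
    ⟨{ toFun := Log, map_add' := map_add Log, map_smul' := fun f y ↦ hLog.1 f y }, fun _ ↦ rfl⟩
  obtain ⟨locₗ, hlocₗ⟩ : ∃ locₗ : selmerLambdaAdic W p κ γ (fun _ ↦ .sgn ε) →ₗ[IwasawaAlgebra p]
      localSignedLambdaAdic (W.baseChange (𝔭.adicCompletion K)) p (localizeAt κ 𝔭 h𝔭) γ𝔭 ε,
      ∀ x, locₗ x = locSignedAt W p κ 𝔭 h𝔭 γ γ𝔭 hγ𝔭 (fun _ ↦ .sgn ε) ε rfl h𝔭p x :=
    ⟨{ toFun := fun x ↦ locSignedAt W p κ 𝔭 h𝔭 γ γ𝔭 hγ𝔭 (fun _ ↦ .sgn ε) ε rfl h𝔭p x,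
       map_add' := map_add _, map_smul' := fun f x ↦ hloc_smul f x }, fun _ ↦ rfl⟩
  obtain ⟨loc'ₗ, hloc'ₗ⟩ : ∃ loc'ₗ : selmerLambdaAdic W p κ γ (PCond.at 𝔭' .rel (.sgn ε))
      →ₗ[IwasawaAlgebra p]
      localSignedLambdaAdic (W.baseChange (𝔭.adicCompletion K)) p (localizeAt κ 𝔭 h𝔭) γ𝔭 ε,
      ∀ x, loc'ₗ x = locSignedAt W p κ 𝔭 h𝔭 γ γ𝔭 hγ𝔭 (PCond.at 𝔭' .rel (.sgn ε)) ε
        (PCond.at_of_ne .rel (.sgn ε) h𝔭𝔭') h𝔭p x :=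
    ⟨{ toFun := fun x ↦ locSignedAt W p κ 𝔭 h𝔭 γ γ𝔭 hγ𝔭 (PCond.at 𝔭' .rel (.sgn ε)) ε
          (PCond.at_of_ne .rel (.sgn ε) h𝔭𝔭') h𝔭p x,
       map_add' := map_add _, map_smul' := fun f x ↦ hloc'_smul f x }, fun _ ↦ rfl⟩
  -- `ψ = Log ∘ loc_𝔭 : Sel_ε → Λ` and `ψ' = Log ∘ loc_𝔭 : Sel^{ε,rel} → Λ`
  obtain ⟨ψ, hψ⟩ : ∃ ψ : selmerLambdaAdic W p κ γ (fun _ ↦ .sgn ε) →ₗ[IwasawaAlgebra p]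
      IwasawaAlgebra p, ∀ x, ψ x = Log (locSignedAt W p κ 𝔭 h𝔭 γ γ𝔭 hγ𝔭 (fun _ ↦ .sgn ε) ε rfl h𝔭p x) :=
    ⟨Logₗ ∘ₗ locₗ, fun x ↦ by rw [LinearMap.comp_apply, hlocₗ, hLogₗ]⟩
  obtain ⟨ψ', hψ'⟩ : ∃ ψ' : selmerLambdaAdic W p κ γ (PCond.at 𝔭' .rel (.sgn ε)) →ₗ[IwasawaAlgebra p]
      IwasawaAlgebra p, ∀ x, ψ' x = Log (locSignedAt W p κ 𝔭 h𝔭 γ γ𝔭 hγ𝔭 (PCond.at 𝔭' .rel (.sgn ε)) ε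
        (PCond.at_of_ne .rel (.sgn ε) h𝔭𝔭') h𝔭p x) :=
    ⟨Logₗ ∘ₗ loc'ₗ, fun x ↦ by rw [LinearMap.comp_apply, hloc'ₗ, hLogₗ]⟩
  -- `a = Log(loc_𝔭 z) ≠ 0` (Cor. 6.4: `loc_𝔭 z` is not torsion, in particular non-zero; `Log` injective)
  have ha : ψ z ≠ 0 := by
    intro ha0
    rw [hψ] at ha0
    have h0 : locSignedAt W p κ 𝔭 h𝔭 γ γ𝔭 hγ𝔭 (fun _ ↦ .sgn ε) ε rfl h𝔭p z = 0 :=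
      hLog.2.1 (by rw [map_zero]; exact ha0)
    have h1 : (1 : IwasawaAlgebra p) = 0 := h.loc_nonTorsion 1 (by rw [h0, smul_zero])
    exact one_ne_zero h1
  have hιa : IwasawaAlgebra.invol p (ψ z) ≠ 0 := fun h0 ↦
    ha (IwasawaAlgebra.invol_injective p (by rw [h0, map_zero]))
  -- the ideals `I = Log(loc(Sel_ε)) ⊆ I' = Log(loc(Sel^{ε,rel}))`
  have haI : ψ z ∈ LinearMap.range ψ := ⟨z, rfl⟩
  have hII' : LinearMap.range ψ ≤ LinearMap.range ψ' := by
    rintro _ ⟨x, rfl⟩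
    exact ⟨AddSubgroup.inclusion hle x, by rw [hψ', hψ, hloc'_incl]⟩
  have haI' : ψ z ∈ LinearMap.range ψ' := hII' haI
  -- the twisted cokernels as quotients of `Λ` ((6.13), (6.12))
  obtain ⟨δ', hδ'lin, hδ'ker, hδ'im⟩ := h.exact613
  obtain ⟨δ, hδlin, hδker, hδim⟩ := h.exact612
  obtain ⟨Φ', hΦ'im, hΦ'ker⟩ := exists_linearMap_range_eq_ker_eq_of_semilinear
    (fun x ↦ locSignedAt W p κ 𝔭 h𝔭 γ γ𝔭 hγ𝔭 (fun _ ↦ .sgn ε) ε rfl h𝔭p x) Log hLog.1 hLog.2 δ'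
    hδ'lin hδ'ker (LinearMap.range ψ) (fun f ↦ by
      rw [LinearMap.mem_range]
      exact exists_congr fun x ↦ by rw [hψ])
  obtain ⟨Φ, hΦim, hΦker⟩ := exists_linearMap_range_eq_ker_eq_of_semilinear
    (fun x ↦ locSignedAt W p κ 𝔭 h𝔭 γ γ𝔭 hγ𝔭 (PCond.at 𝔭' .rel (.sgn ε)) ε
      (PCond.at_of_ne .rel (.sgn ε) h𝔭𝔭') h𝔭p x) Log hLog.1 hLog.2 δ
    hδlin hδker (LinearMap.range ψ') (fun f ↦ by
      rw [LinearMap.mem_range]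
      exact exists_congr fun x ↦ by rw [hψ'])
  -- the restriction maps `r' : X^{rel,ε} ↠ X_ε`, `r : X^{rel,str} ↠ X^{ε,str}` and their kernels
  obtain ⟨r', hr'_apply, hr'_surj⟩ := X.exists_restrict_linearMap W p κ hγ
    (selmer_sgn_le_at_rel W p κ ∅ 𝔭 ε)
  obtain ⟨r, hr_apply, hr_surj⟩ := X.exists_restrict_linearMap W p κ hγ
    (selmer_at_le_rel_away W p κ ∅ (𝔮 := 𝔭') .str (.sgn ε))
  have hker_r' : LinearMap.ker r' = LinearMap.range Φ' := by
    ext x'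
    rw [LinearMap.mem_ker, hr'_apply, ← hδ'im x', LinearMap.mem_range]
    exact (hΦ'im x').symm
  have hker_r : LinearMap.ker r = LinearMap.range Φ := by
    ext x'
    rw [LinearMap.mem_ker, hr_apply, ← hδim x', LinearMap.mem_range]
    exact (hΦim x').symm
  -- both kernels are killed by `ι(a) ≠ 0` (`ι a ∈ ι(I) = ker Φ' ⊆ ι(I') = ker Φ`)
  have hY'tors : ∀ x ∈ LinearMap.ker r', IwasawaAlgebra.invol p (ψ z) • x = 0 := by
    intro x hx
    rw [hker_r', LinearMap.mem_range] at hx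
    obtain ⟨f, rfl⟩ := hx
    have h0 : Φ' (IwasawaAlgebra.invol p (ψ z)) = 0 := by
      rw [← LinearMap.mem_ker, hΦ'ker]
      exact Ideal.mem_map_of_mem _ haI
    rw [← map_smul, smul_eq_mul, mul_comm, ← smul_eq_mul, map_smul, h0, smul_zero]
  have hYtors : ∀ x ∈ LinearMap.ker r, IwasawaAlgebra.invol p (ψ z) • x = 0 := by
    intro x hx
    rw [hker_r, LinearMap.mem_range] at hx
    obtain ⟨f, rfl⟩ := hx
    have h0 : Φ (IwasawaAlgebra.invol p (ψ z)) = 0 := by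
      rw [← LinearMap.mem_ker, hΦker]
      exact Ideal.mem_map_of_mem _ haI'
    rw [← map_smul, smul_eq_mul, mul_comm, ← smul_eq_mul, map_smul, h0, smul_zero]
  -- the abstract chain: ranks and torsion from Lemma 6.7 (2)
  obtain ⟨htors_rs, htors_es, hrank_re, -⟩ :=
    Module.isTorsion_and_charIdeal_eq_of_surjective_pair r' hr'_surj r hr_surj
      (IwasawaAlgebra.invol p (ψ z)) hιa hY'tors hYtors hX.2 h.lemma67.1 h.lemma67.2
  exact ⟨⟨inferInstance, htors_rs⟩, htors_es, ⟨inferInstance, hrank_re⟩⟩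

end Assembly

/-! ## The reading on `Castella2018.AcSelmer.XAc` for a base change `W⁄K` -/

section Corollary

variable {K : Type} [Field K] [NumberField K] {W : WeierstrassCurve ℚ} {p : ℕ} [Fact p.Prime]
  {κ : ZpExtension K p} {γ : absoluteGaloisGroup K} [hγF : Fact (κ.IsTopGenerator γ)]
  {𝔭 : HeightOneSpectrum (𝓞 K)} {h𝔭 : IsNonsplitIn κ 𝔭} {γ𝔭 : absoluteGaloisGroup (𝔭.adicCompletion K)}
  {hγ𝔭 : κ (resGalOfEmb (closureEmb (K := K) (𝔭.adicCompletion K)) γ𝔭) = κ γ}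
  {𝔭' : HeightOneSpectrum (𝓞 K)} {h𝔭𝔭' : 𝔭 ≠ 𝔭'} {h𝔭p : ((p : ℕ) : 𝓞 K) ∈ 𝔭.asIdeal} {ε : ℤˣ}
  {z : selmerLambdaAdic (W.baseChange K) p κ γ (fun _ ↦ .sgn ε)} {L : UnrSeries p}

/-- **`X_ac(E[p^∞])` (strict at `𝔭'`, relaxed at `𝔭`, trivial away from `p`) is `Λ`-torsion from the
transfer inputs and `rank_Λ X_ε = 1`.** For `E/ℚ` elliptic with model `W`, base-changed to `K`, `p ∈ 𝔭'`:
`TransferInputs (W⁄K) p κ γ … ε z L` + `X.HasRank (W⁄K) p κ ∅ (sgn ε) 1` ⟹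
`Module.IsTorsion Λ (AcSelmer.XAc (W⁄K) p κ 𝔭' ∅ γ)` (bridge `X.isTorsion_XAc_of_at_str_rel`). This is
the one-variable torsion input (a) of line `bdpline` in the currency of the crux, modulo its two sources.
[cite: CastellaWan2023, proof of Thm. 6.8 (MS p. 30)] [cite: Castella2018, Def. 2.2 (arXiv:1704.06608 p. 5)] -/
theorem TransferInputs.isTorsion_XAc_of_hasRank [W.IsElliptic]
    (h : TransferInputs (W.baseChange K) p κ γ hγF.out 𝔭 h𝔭 γ𝔭 hγ𝔭 𝔭' h𝔭𝔭' h𝔭p ε z L)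
    (h𝔭'p : ((p : ℕ) : 𝓞 K) ∈ 𝔭'.asIdeal)
    (hX : X.HasRank (W.baseChange K) p κ ∅ (fun _ ↦ .sgn ε) hγF.out 1) :
    Module.IsTorsion (IwasawaAlgebra p) (Castella2018.AcSelmer.XAc (W.baseChange K) p κ 𝔭' ∅ γ) :=
  X.isTorsion_XAc_of_at_str_rel (W.baseChange K) p κ ∅ γ h𝔭'p
    (TransferInputs.isFGTorsion_at_str_rel_of_hasRank h hX).1.2

end Corollary

end Summit.BirchSwinnertonDyer.BirchSwinnertonDyer.Theorems.SignedBaseChangeAcDivXAcTorsionTransfer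

end
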